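import Summits.AtomisticToContinuum.Crystallization.Theorems.FreeSplittingCertificatesStrictSplittingRuleHcpShellMoments
import Summits.AtomisticToContinuum.Crystallization.Theorems.FreeSplittingCertificatesStrictSplittingRuleP1AssemblyGlue
import Summits.AtomisticToContinuum.Crystallization.Theorems.ChessboardParticlePlanesLjBilayerHcpNumericReductionAux
import Literature.Probability.LatticeModels.TriangularLatticeProofs

/-!
# `StrictSplittingRule` (stmt-AtomisticToContinuum-12560): THE FIRST SHELL OF H12⋆ IS THE TWELVE-STAR — the `hSH` bookkeeping hypothesis of the endpoint (P1 interpolant object, part 62)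

Route `FreeSplittingCertificates`, crux r3 `StrictSplittingRule` (H12⋆ = `stub_coreJointCoercive`), unit b2b-freesplit-B gen 33.
VALUE = kernel discharge of the index-set hypothesis `hSH` of `nearLedger_of_finite` / `coreJointCoercive_of_certificates` (parts 59/60): on the ratio box
`3a/4 ≤ h ≤ 9a/10` (which contains the `HcpFamilyMin` box `0.81619a ≤ h ≤ 0.81657a`), the real condition of `CoreJointSiteIneq`'s shell sums
`0 < ‖y_q − y_p‖ ≤ (11/10)a` holds EXACTLY for `q − p` in the twelve-star `hcpStarIdx` (even layer of `p`) / `p − q ∈ hcpStarIdx` (odd layer):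
* `mem_hcpStarIdx_iff_norm` — `(0 < ‖y_v‖ ∧ ‖y_v‖ ≤ (11/10)a) ↔ v ∈ hcpStarIdx` (`‖y_v‖² = a²Q(v) + k²h²`: `|k| ≥ 2` costs `4h² > (11/10)²a²`; in the layer `i²+ij+j² = 1`;
  across one layer `i²+ij+j²+i+j = 0` — three integer points; the integer lemmas `int_sol_of_quadForm_eq_one` (Literature, triangular lattice) and
  `LjBilayerHcpSketch.int_oddForm_nonneg` are reused);
* `shell_iff_mem` — the site version at any base site `p` with the explicit finset `if Even p.1 then hcpStarIdx.image (· + p) else hcpStarIdx.image (p − ·)`;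
* `shell_iff_mem_of_hcpFamilyMin` — the same on the `HcpFamilyMin` box.
NOT a proof of H12⋆, NOT summit progress.  [folklore]
-/

noncomputable section

open scoped BigOperators Classical

namespace Summit.AtomisticToContinuum.Crystallization.Theorems.StrictSplittingRuleBirth

open Literature.MathematicalPhysics.StatisticalMechanics
open Summit.AtomisticToContinuum.Crystallization.Theorems.PalmUnimodularRigidity.LayeredLawsSelectHcp

/-- Integer solutions of `i² + ij + j² + i + j = 0`: the three cross-layer star labels. -/
theorem int_hexNormOdd_eq_zero {i j : ℤ} (h0 : i ^ 2 + i * j + j ^ 2 + i + j = 0) :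
    (i = 0 ∧ j = 0) ∨ (i = -1 ∧ j = 0) ∨ (i = 0 ∧ j = -1) := by
  have hj : (3 * j + 1) ^ 2 ≤ 4 := by nlinarith [sq_nonneg (2 * i + j + 1)]
  have hi : (3 * i + 1) ^ 2 ≤ 4 := by nlinarith [sq_nonneg (2 * j + i + 1)]
  have hj' : -1 ≤ j ∧ j ≤ 0 := by constructor <;> nlinarith
  have hi' : -1 ≤ i ∧ i ≤ 0 := by constructor <;> nlinarith
  obtain ⟨hi1, hi2⟩ := hi'
  obtain ⟨hj1, hj2⟩ := hj'
  interval_cases i <;> interval_cases j <;> simp_all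

/-- **THE FIRST SHELL IS THE TWELVE-STAR**: on the ratio box `3a/4 ≤ h ≤ 9a/10`, `0 < ‖y_v‖ ≤ (11/10)a` iff `v ∈ hcpStarIdx`.  NOT a proof of H12⋆, NOT summit progress. -/
theorem mem_hcpStarIdx_iff_norm {a h : ℝ} (ha : 0 < a) (hlo : 3 / 4 * a ≤ h) (hhi : h ≤ 9 / 10 * a) (v : ℤ × ℤ × ℤ) :
    (0 < ‖hcpSite a h v‖ ∧ ‖hcpSite a h v‖ ≤ 11 / 10 * a) ↔ v ∈ hcpStarIdx := by
  have hh : 0 < h := lt_of_lt_of_le (by positivity) hlo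
  constructor
  · rintro ⟨hpos, hle⟩
    have hN := hcpSite_norm_sq a h v
    have hle2 : ‖hcpSite a h v‖ ^ 2 ≤ (11 / 10 * a) ^ 2 := pow_le_pow_left₀ (norm_nonneg _) hle 2
    have hpos2 : 0 < ‖hcpSite a h v‖ ^ 2 := by positivity
    obtain ⟨k, i, j⟩ := v
    simp only [hcpQ] at hN
    -- |k| ≥ 2 is too far
    have hk : k = 0 ∨ k = 1 ∨ k = -1 := by
      by_contra hk
      have hk2 : (2 : ℤ) ≤ |k| := by
        rcases le_or_gt 0 k with h0 | h0
        · rw [abs_of_nonneg h0]; omega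
        · rw [abs_of_neg h0]; omega
      have hk2' : (4 : ℝ) ≤ (k : ℝ) ^ 2 := by
        have : (2 : ℝ) ≤ |(k : ℝ)| := by exact_mod_cast hk2
        nlinarith [abs_nonneg (k : ℝ), sq_abs (k : ℝ)]
      have hQ0 : 0 ≤ ((i : ℝ) ^ 2 + (i : ℝ) * j + (j : ℝ) ^ 2 + if Even k then (0 : ℝ) else (i : ℝ) + j + 1 / 3) := by
        have := hcpQ_nonneg (k, i, j)
        simp only [hcpQ] at this
        exact this
      nlinarith [hle2, hN, hQ0, mul_nonneg (le_of_lt (pow_pos ha 2)) hQ0]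
    rcases hk with rfl | rfl | rfl
    · -- in the layer: i² + ij + j² = 1
      have h0 : Even (0 : ℤ) := ⟨0, rfl⟩
      simp only [Int.cast_zero, if_pos h0] at hN
      have hn1 : (i : ℝ) ^ 2 + (i : ℝ) * j + (j : ℝ) ^ 2 ≤ 121 / 100 := by nlinarith [hle2, hN, pow_pos ha 2]
      have hn0 : 0 < (i : ℝ) ^ 2 + (i : ℝ) * j + (j : ℝ) ^ 2 := by nlinarith [hpos2, hN, pow_pos ha 2]
      have hcast : ((i ^ 2 + i * j + j ^ 2 : ℤ) : ℝ) = (i : ℝ) ^ 2 + (i : ℝ) * j + (j : ℝ) ^ 2 := by push_cast; ring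
      have hn1' : i ^ 2 + i * j + j ^ 2 ≤ 1 := by
        by_contra hc
        have h2 : ((2 : ℤ) : ℝ) ≤ ((i ^ 2 + i * j + j ^ 2 : ℤ) : ℝ) := by exact_mod_cast (by omega : (2 : ℤ) ≤ i ^ 2 + i * j + j ^ 2)
        rw [hcast] at h2
        norm_num at h2
        linarith
      have hn0' : 0 < i ^ 2 + i * j + j ^ 2 := by
        have h2 : ((0 : ℤ) : ℝ) < ((i ^ 2 + i * j + j ^ 2 : ℤ) : ℝ) := by rw [hcast]; exact_mod_cast hn0
        exact_mod_cast h2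
      have heq : i ^ 2 + i * j + j ^ 2 = 1 := le_antisymm hn1' hn0'
      rcases Literature.Probability.LatticeModels.int_sol_of_quadForm_eq_one heq with ⟨rfl, rfl⟩ | ⟨rfl, rfl⟩ | ⟨rfl, rfl⟩ | ⟨rfl, rfl⟩ | ⟨rfl, rfl⟩ | ⟨rfl, rfl⟩ <;> decide
    · -- one layer up: i² + ij + j² + i + j = 0
      have hodd : ¬Even (1 : ℤ) := Int.not_even_one
      simp only [Int.cast_one, hodd, if_false, one_pow, one_mul] at hN
      have hm : (i : ℝ) ^ 2 + (i : ℝ) * j + (j : ℝ) ^ 2 + (i : ℝ) + j < 1 := by nlinarith [hle2, hN, pow_pos ha 2]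
      have hcast : ((i ^ 2 + i * j + j ^ 2 + i + j : ℤ) : ℝ) = (i : ℝ) ^ 2 + (i : ℝ) * j + (j : ℝ) ^ 2 + (i : ℝ) + j := by push_cast; ring
      have hm' : i ^ 2 + i * j + j ^ 2 + i + j ≤ 0 := by
        by_contra hc
        have h2 : ((1 : ℤ) : ℝ) ≤ ((i ^ 2 + i * j + j ^ 2 + i + j : ℤ) : ℝ) := by
          exact_mod_cast (by omega : (1 : ℤ) ≤ i ^ 2 + i * j + j ^ 2 + i + j)
        rw [hcast] at h2
        norm_num at h2
        linarith
      have heq : i ^ 2 + i * j + j ^ 2 + i + j = 0 := le_antisymm hm' (Summit.AtomisticToContinuum.Crystallization.Theorems.LjBilayerHcpSketch.int_oddForm_nonneg i j)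
      rcases int_hexNormOdd_eq_zero heq with ⟨rfl, rfl⟩ | ⟨rfl, rfl⟩ | ⟨rfl, rfl⟩ <;> decide
    · -- one layer down
      have hodd : ¬Even (-1 : ℤ) := by decide
      simp only [Int.cast_neg, Int.cast_one, hodd, if_false, neg_one_sq, one_mul] at hN
      have hm : (i : ℝ) ^ 2 + (i : ℝ) * j + (j : ℝ) ^ 2 + (i : ℝ) + j < 1 := by nlinarith [hle2, hN, pow_pos ha 2]
      have hcast : ((i ^ 2 + i * j + j ^ 2 + i + j : ℤ) : ℝ) = (i : ℝ) ^ 2 + (i : ℝ) * j + (j : ℝ) ^ 2 + (i : ℝ) + j := by push_cast; ring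
      have hm' : i ^ 2 + i * j + j ^ 2 + i + j ≤ 0 := by
        by_contra hc
        have h2 : ((1 : ℤ) : ℝ) ≤ ((i ^ 2 + i * j + j ^ 2 + i + j : ℤ) : ℝ) := by
          exact_mod_cast (by omega : (1 : ℤ) ≤ i ^ 2 + i * j + j ^ 2 + i + j)
        rw [hcast] at h2
        norm_num at h2
        linarith
      have heq : i ^ 2 + i * j + j ^ 2 + i + j = 0 := le_antisymm hm' (Summit.AtomisticToContinuum.Crystallization.Theorems.LjBilayerHcpSketch.int_oddForm_nonneg i j)
      rcases int_hexNormOdd_eq_zero heq with ⟨rfl, rfl⟩ | ⟨rfl, rfl⟩ | ⟨rfl, rfl⟩ <;> decide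
  · intro hv
    have hsq := hcpShell_norm_sq a h hv
    have hle2 : ‖hcpSite a h v‖ ^ 2 ≤ (11 / 10 * a) ^ 2 := by
      rw [hsq]
      split_ifs <;> nlinarith [pow_pos ha 2]
    have hpos2 : 0 < ‖hcpSite a h v‖ ^ 2 := by
      rw [hsq]
      split_ifs <;> positivity
    refine ⟨?_, ?_⟩
    · have := norm_nonneg (hcpSite a h v)
      rcases this.eq_or_lt with h0 | h0
      · rw [← h0] at hpos2; norm_num at hpos2
      · exact h0
    · exact (pow_le_pow_iff_left₀ (norm_nonneg _) (by positivity) two_ne_zero).1 hle2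

/-- **THE SHELL OF A BASE SITE AS AN EXPLICIT FINSET** (the `hSH` hypothesis of parts 59/60): at `p`, `0 < ‖y_q − y_p‖ ≤ (11/10)a` iff
`q ∈ (if Even p.1 then hcpStarIdx.image (· + p) else hcpStarIdx.image (p − ·))`.  NOT a proof of H12⋆, NOT summit progress. -/
theorem shell_iff_mem {a h : ℝ} (ha : 0 < a) (hlo : 3 / 4 * a ≤ h) (hhi : h ≤ 9 / 10 * a) (p q : ℤ × ℤ × ℤ) :
    (0 < ‖hcpSite a h q - hcpSite a h p‖ ∧ ‖hcpSite a h q - hcpSite a h p‖ ≤ 11 / 10 * a) ↔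
      q ∈ (if Even p.1 then hcpStarIdx.image (fun d => d + p) else hcpStarIdx.image (fun d => p - d)) := by
  rcases Int.even_or_odd p.1 with hp | hp
  · have e : hcpSite a h q - hcpSite a h p = hcpSite a h (q - p) := by
      have := h1_sub_of_even a h hp (q - p)
      rwa [add_sub_cancel] at this
    rw [e, mem_hcpStarIdx_iff_norm ha hlo hhi, if_pos hp, Finset.mem_image]
    constructor
    · intro hm; exact ⟨q - p, hm, sub_add_cancel q p⟩
    · rintro ⟨d, hd, rfl⟩; rwa [add_sub_cancel_right]
  · have e : hcpSite a h q - hcpSite a h p = -hcpSite a h (p - q) := by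
      have := h1_sub_of_odd a h hp (q - p)
      rwa [add_sub_cancel, neg_sub] at this
    rw [e, norm_neg, mem_hcpStarIdx_iff_norm ha hlo hhi, if_neg (Int.not_even_iff_odd.2 hp), Finset.mem_image]
    constructor
    · intro hm; exact ⟨p - q, hm, sub_sub_cancel p q⟩
    · rintro ⟨d, hd, rfl⟩; rwa [sub_sub_cancel]

/-- The same on the `HcpFamilyMin` box. -/
theorem shell_iff_mem_of_hcpFamilyMin {a h : ℝ} (ha : 0 < a) (hh : 0 < h) (hfam : HcpFamilyMin a h) (p q : ℤ × ℤ × ℤ) :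
    (0 < ‖hcpSite a h q - hcpSite a h p‖ ∧ ‖hcpSite a h q - hcpSite a h p‖ ≤ 11 / 10 * a) ↔
      q ∈ (if Even p.1 then hcpStarIdx.image (fun d => d + p) else hcpStarIdx.image (fun d => p - d)) := by
  obtain ⟨hlo, hhi⟩ := ratioBox_of_hcpFamilyMin ha hh hfam
  exact shell_iff_mem ha (by linarith) (by linarith) p q

end Summit.AtomisticToContinuum.Crystallization.Theorems.StrictSplittingRuleBirth

end
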